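import Mathlib

/-!
# Idempotents of the semigroup `𝒞ₙ` of order-preserving order-decreasing transformations

[Ganyushkin–Mazorchuk 2009, §14.3, Proposition 14.3.2 and Exercise 14.3.3].  `𝒞(X) = 𝒪(X) ∩ ℱ(X)`
is the semigroup of transformations `δ : X → X` of a chain `X` which are order-preserving
(monotone) and order-decreasing (`δ x ≤ x`); as everywhere in this directory `𝒯(X)` is
`X → X` under `∘` and `im δ = Set.range δ`.

* Proposition 14.3.2: an idempotent `δ ∈ 𝒞(X)` maps `x` to the largest element of `im δ` below
  `x` (`isGreatest_apply_of_idempotent`), so it is uniquely determined by its image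
  (`idempotent_eq_of_range_eq`); conversely every finite set `A ⊆ X` such that every `x` has an
  element of `A` below it (for `X = {1 < ⋯ < n}`: every `A ∋ 1`) is the image of such an
  idempotent (`exists_idempotent_range_eq`); hence `|E(𝒞ₙ)| = 2ⁿ⁻¹`
  (`card_idempotents`, stated for `Fin (n + 1)`);
* Exercise 14.3.3: `𝒞ₙ` contains `(n-1 choose k-1)` idempotents of rank `k`
  (`card_idempotents_rank`, stated for `Fin (n + 1)` and rank `k + 1`).

## References
* [GanyushkinMazorchuk2009] O. Ganyushkin, V. Mazorchuk, *Classical Finite Transformation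
  Semigroups. An Introduction*, Algebra and Applications 9, Springer, 2009, §14.3.
-/

namespace Literature.Algebra.Semigroups.OrderPreserving

open Function Set

variable {X : Type*}

/-- Proposition 14.3.2 (key step, any preorder): if `δ` is order-preserving, order-decreasing
and idempotent, then `δ x` is the greatest element of `im δ` lying below `x`
(for `a = δ a ≤ x` one has `a = δ a ≤ δ x`).
[cite: GanyushkinMazorchuk2009, Proposition 14.3.2 (proof)] -/
theorem isGreatest_apply_of_idempotent [Preorder X] {δ : X → X} (hm : Monotone δ)
    (hd : ∀ x, δ x ≤ x) (hi : δ ∘ δ = δ) (x : X) :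
    IsGreatest {a | a ∈ range δ ∧ a ≤ x} (δ x) := by
  refine ⟨⟨mem_range_self x, hd x⟩, ?_⟩
  rintro a ⟨⟨a', rfl⟩, hax⟩
  calc δ a' = δ (δ a') := (congrFun hi a').symm
    _ ≤ δ x := hm hax

/-- Proposition 14.3.2: an idempotent of `𝒞(X)` is uniquely determined by its image.
[cite: GanyushkinMazorchuk2009, Proposition 14.3.2] -/
theorem idempotent_eq_of_range_eq [PartialOrder X] {δ₁ δ₂ : X → X} (hm₁ : Monotone δ₁)
    (hd₁ : ∀ x, δ₁ x ≤ x) (hi₁ : δ₁ ∘ δ₁ = δ₁) (hm₂ : Monotone δ₂) (hd₂ : ∀ x, δ₂ x ≤ x)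
    (hi₂ : δ₂ ∘ δ₂ = δ₂) (h : range δ₁ = range δ₂) : δ₁ = δ₂ := by
  funext x
  have h1 := isGreatest_apply_of_idempotent hm₁ hd₁ hi₁ x
  rw [h] at h1
  exact h1.unique (isGreatest_apply_of_idempotent hm₂ hd₂ hi₂ x)

/-- Proposition 14.3.2 (existence half): every finite subset `A` of a chain such that each `x`
has some element of `A` below it (for `X = {1 < ⋯ < n}`: each `A` containing `1`; "the set
`{a₂, …, a_k}` can be an arbitrary subset of `{2, …, n}`") is the image of an idempotent of
`𝒞(X)`, namely of `x ↦ max {a ∈ A | a ≤ x}`.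
[cite: GanyushkinMazorchuk2009, Proposition 14.3.2] -/
theorem exists_idempotent_range_eq [LinearOrder X] (A : Finset X) (hA : ∀ x, ∃ a ∈ A, a ≤ x) :
    ∃ δ : X → X, Monotone δ ∧ (∀ x, δ x ≤ x) ∧ δ ∘ δ = δ ∧ range δ = ↑A := by
  classical
  have hne : ∀ x, (A.filter (· ≤ x)).Nonempty := fun x => by
    obtain ⟨a, ha, hax⟩ := hA x
    exact ⟨a, Finset.mem_filter.2 ⟨ha, hax⟩⟩
  have hmemA : ∀ x, (A.filter (· ≤ x)).max' (hne x) ∈ A := fun x =>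
    (Finset.mem_filter.1 (Finset.max'_mem _ (hne x))).1
  have hle : ∀ x, (A.filter (· ≤ x)).max' (hne x) ≤ x := fun x =>
    Finset.max'_le _ (hne x) _ fun a ha => (Finset.mem_filter.1 ha).2
  have hfix : ∀ a ∈ A, (A.filter (· ≤ a)).max' (hne a) = a := fun a ha =>
    le_antisymm (hle a) (Finset.le_max' (A.filter (· ≤ a)) a (Finset.mem_filter.2 ⟨ha, le_rfl⟩))
  refine ⟨fun x => (A.filter (· ≤ x)).max' (hne x), ?_, hle, ?_, ?_⟩
  · intro x y hxy
    refine Finset.max'_subset (hne x) fun a ha => ?_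
    rw [Finset.mem_filter] at ha ⊢
    exact ⟨ha.1, ha.2.trans hxy⟩
  · funext x
    exact hfix _ (hmemA x)
  · ext a
    constructor
    · rintro ⟨x, rfl⟩
      exact hmemA x
    · intro ha
      exact ⟨a, hfix a ha⟩

/-- An idempotent of `𝒞(X)` fixes the least element. [folklore] -/
private theorem apply_bot [PartialOrder X] [OrderBot X] {δ : X → X} (hd : ∀ x, δ x ≤ x) :
    δ ⊥ = ⊥ :=
  le_bot_iff.1 (hd ⊥)

/-- The bijection behind the count in Proposition 14.3.2 / Exercise 14.3.3: idempotents of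
`𝒞ₙ₊₁` (on `Fin (n + 1) = {0 < 1 < ⋯ < n}`) correspond to subsets of `{1, …, n}` via
`δ ↦ im δ ∖ {0}`; recorded as the existence of an equivalence with `Finset (Fin n)` lowering
the rank by one. [folklore] -/
private theorem exists_equiv_finset (n : ℕ) :
    ∃ e : {δ : Fin (n + 1) → Fin (n + 1) // Monotone δ ∧ (∀ x, δ x ≤ x) ∧ δ ∘ δ = δ} ≃
        Finset (Fin n), ∀ δ, (e δ).card + 1 = (Finset.univ.image δ.1).card := by
  classical
  -- Step 1: idempotents of 𝒞ₙ₊₁ ≃ subsets of `Fin (n + 1)` containing `0` (δ ↦ im δ).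
  have h0 : ∀ A : {A : Finset (Fin (n + 1)) // 0 ∈ A}, ∀ x, ∃ a ∈ A.1, a ≤ x :=
    fun A x => ⟨0, A.2, Fin.zero_le _⟩
  have key : ∀ A : {A : Finset (Fin (n + 1)) // 0 ∈ A},
      (Monotone (Classical.choose (exists_idempotent_range_eq A.1 (h0 A))) ∧
        (∀ x, Classical.choose (exists_idempotent_range_eq A.1 (h0 A)) x ≤ x) ∧
        Classical.choose (exists_idempotent_range_eq A.1 (h0 A)) ∘
          Classical.choose (exists_idempotent_range_eq A.1 (h0 A)) =
          Classical.choose (exists_idempotent_range_eq A.1 (h0 A))) ∧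
      range (Classical.choose (exists_idempotent_range_eq A.1 (h0 A))) = ↑A.1 := fun A => by
    obtain ⟨h1, h2, h3, h4⟩ := Classical.choose_spec (exists_idempotent_range_eq A.1 (h0 A))
    exact ⟨⟨h1, h2, h3⟩, h4⟩
  have hcoe : ∀ δ : Fin (n + 1) → Fin (n + 1), (↑(Finset.univ.image δ) : Set (Fin (n + 1))) =
      range δ := fun δ => by
    rw [Finset.coe_image, Finset.coe_univ, image_univ]
  let e₁ : {δ : Fin (n + 1) → Fin (n + 1) // Monotone δ ∧ (∀ x, δ x ≤ x) ∧ δ ∘ δ = δ} ≃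
      {A : Finset (Fin (n + 1)) // 0 ∈ A} :=
    { toFun := fun δ => ⟨Finset.univ.image δ.1,
        Finset.mem_image.2 ⟨0, Finset.mem_univ _, apply_bot δ.2.2.1⟩⟩
      invFun := fun A => ⟨Classical.choose (exists_idempotent_range_eq A.1 (h0 A)), (key A).1⟩
      left_inv := by
        rintro ⟨δ, hm, hd, hi⟩
        apply Subtype.ext
        exact idempotent_eq_of_range_eq (key _).1.1 (key _).1.2.1 (key _).1.2.2 hm hd hi
          (((key _).2).trans (hcoe δ))
      right_inv := by
        intro A
        apply Subtype.ext
        exact Finset.coe_injective ((hcoe _).trans (key A).2) }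
  -- Step 2: subsets of `Fin (n + 1)` containing `0` ≃ subsets of `Fin n` (shift by one).
  let e₂ : {A : Finset (Fin (n + 1)) // 0 ∈ A} ≃ Finset (Fin n) :=
    { toFun := fun A => Finset.univ.filter fun i => i.succ ∈ A.1
      invFun := fun B => ⟨insert 0 (B.map ⟨Fin.succ, Fin.succ_injective n⟩),
        Finset.mem_insert_self _ _⟩
      left_inv := by
        rintro ⟨A, hA⟩
        apply Subtype.ext
        ext x
        simp only [Finset.mem_insert, Finset.mem_map, Finset.mem_filter, Finset.mem_univ,
          true_and, Embedding.coeFn_mk]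
        constructor
        · rintro (rfl | ⟨i, hi, rfl⟩)
          · exact hA
          · exact hi
        · intro hx
          rcases Fin.eq_zero_or_eq_succ x with rfl | ⟨j, rfl⟩
          · exact Or.inl rfl
          · exact Or.inr ⟨j, hx, rfl⟩
      right_inv := by
        intro B
        ext i
        simp [Fin.succ_ne_zero] }
  have hcard : ∀ A : {A : Finset (Fin (n + 1)) // 0 ∈ A}, (e₂ A).card + 1 = A.1.card := by
    intro A
    have h := congrArg Subtype.val (e₂.symm_apply_apply A)
    rw [← h]
    show (e₂ A).card + 1 = (insert 0 ((e₂ A).map ⟨Fin.succ, Fin.succ_injective n⟩)).card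
    rw [Finset.card_insert_of_notMem (by simp [Fin.succ_ne_zero]), Finset.card_map]
  exact ⟨e₁.trans e₂, fun δ => hcard (e₁ δ)⟩

/-- Proposition 14.3.2 (count): `|E(𝒞ₙ)| = 2ⁿ⁻¹`; here for the chain `Fin (n + 1)`:
the order-preserving, order-decreasing idempotents of `{0 < 1 < ⋯ < n}` number `2ⁿ`.
[cite: GanyushkinMazorchuk2009, Proposition 14.3.2] -/
theorem card_idempotents (n : ℕ) :
    Fintype.card {δ : Fin (n + 1) → Fin (n + 1) // Monotone δ ∧ (∀ x, δ x ≤ x) ∧ δ ∘ δ = δ} =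
      2 ^ n := by
  obtain ⟨e, -⟩ := exists_equiv_finset n
  rw [Fintype.card_congr e, Fintype.card_finset, Fintype.card_fin]

/-- Exercise 14.3.3: `𝒞ₙ` contains `(n-1 choose k-1)` idempotents of rank `k`; here for the
chain `Fin (n + 1)`: there are `(n choose k)` order-preserving order-decreasing idempotents of
rank `k + 1`. [cite: GanyushkinMazorchuk2009, Exercise 14.3.3] -/
theorem card_idempotents_rank (n k : ℕ) :
    Fintype.card {δ : Fin (n + 1) → Fin (n + 1) //
      (Monotone δ ∧ (∀ x, δ x ≤ x) ∧ δ ∘ δ = δ) ∧ (Finset.univ.image δ).card = k + 1} =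
      n.choose k := by
  classical
  obtain ⟨e, he⟩ := exists_equiv_finset n
  have h1 : Fintype.card {B : Finset (Fin n) // B.card = k} = n.choose k := by
    rw [Fintype.card_finset_len, Fintype.card_fin]
  rw [← h1]
  refine Fintype.card_congr
    ((Equiv.subtypeSubtypeEquivSubtypeInter _ _).symm.trans (e.subtypeEquiv fun δ => ?_))
  rw [← he δ]
  exact Nat.add_right_cancel_iff

end Literature.Algebra.Semigroups.OrderPreserving
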